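import Literature.Probability.LatticeModels.IsingPeierlsFlip
import Literature.Probability.LatticeModels.GriffithsMonotonicity
import Literature.Probability.LatticeModels.SHolomorphicPrimitive
import Literature.Probability.LatticeModels.HoleFreePotential
import Literature.Probability.LatticeModels.PlanarIsing
import HarnessLib

/-!
# Disorder insertions and the Kadanoff–Ceva fermion of the planar Ising model

Topic `Literature/Probability/LatticeModels`. First brick of the lattice side of the programme
behind the named fact `Literature.Probability.LatticeModels.chi_onePoint_rho`
(`PlanarIsingOnePoint.lean`; Chelkak–Hongler–Izyurov, Ann. of Math. 181 (2015) = arXiv:1202.2838,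
"CHI15", Thm 1.3): `PlanarIsingOnePointProofs.lean` reduces that fact to CHI15 Thm 1.1 (the
two-point function, `+` and free boundary conditions), whose printed proof is the convergence
theory of the *discrete spinor observables* `F_{[Ω_δ,a]}` of CHI15 §2.2 (Prop. 2.4:
s-holomorphicity; Lemma 2.6: values next to the branch point are ratios of spin correlations;
Prop. 3.6: the discrete primitive `H = Re ∫ F²`). This file vendors the combinatorial layer of that
theory — everything that is finite-volume algebra — in the **Kadanoff–Ceva / disorder-insertion
form** printed in Chelkak–Hongler–Izyurov, *Correlations of primary fields in the critical Ising
model*, arXiv:2103.10263 ("CHI21"), §2.2–2.3, which replaces CHI15's contour sums with windings by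
plain Gibbs averages:

* CHI21 §1.1 / Lemma 2.4: the **disorder insertion** `μ_T = exp(-2β ∑_{e ∈ T} σ_e)` along a set `T`
  of bonds (a *branch cut*; Kadanoff–Ceva 1971), and the **gauge identity**: flipping the spins of
  `S ⊆ Λ` is a bijection of configurations which "preserves weights, except that the contribution
  of the edges intersecting [`∂S`] comes with the opposite sign" — `isingExpect_comp_flipOn`
  (`⟨f ∘ flip_S⟩ = ⟨μ_{∂S} f⟩`), whence the cut may be moved, `⟨μ_{T ∆ ∂S} σ_B⟩ = (-1)^{|B ∩ S|} ⟨μ_T σ_B⟩`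
  (`isingExpect_disorder_symmDiff_spinProduct`; CHI21 Lemma 2.6: the sign `-1` "every time a spin
  winds around a disorder").
* CHI21 Def. 2.8: the **Kadanoff–Ceva corner value** `X_B(v, T) = ⟨μ_T σ_v σ_B⟩` of the corner
  between the site `v` (CHI21's vertex `z∘`) and the plaquette at which the cut `T` ends (CHI21's
  face `z•`) — `kcCorner` —; its monodromy `kcCorner_symmDiff_edgeBoundary`; frozen sites
  (`kcCorner_of_notMem`: all frozen `+` corners of a boundary plaquette carry the same value, the
  lattice form of the boundary condition (2.4) of CHI15 Prop. 2.4 / CHI21 Def. 2.14); and the empty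
  cut (`kcCorner_empty…`: CHI15 Lemma 2.6 and Remark 2.7 — next to the source no disorder is
  inserted and the observable is a ratio of spin correlations).
* CHI21 Lemma 2.12 (proof): the **propagation identity** across a bond `e = {u, u'}`,
  `X(u, T ∪ e) = cosh 2β · X(u, T) - sinh 2β · X(u', T)` (`kcCorner_insert`; it is
  `e^{-2βξ} = cosh 2β - ξ sinh 2β`, `ξ = σ_uσ_{u'}`, and linearity), at `β_c = ½ log(1 + √2)`:
  `X(u, T ∪ e) = √2 X(u, T) - X(u', T)` (`kcCorner_insert_critical`, `cosh_two_mul_criticalBetaTwo`).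
* Consequences: (i) the **flux form** `X²` is closed around every bond, for any admissible change
  of cut (`kcCorner_sq_add_sq`, `kcCorner_sq_cycle`; any `β`), so that on a hole-free set of
  plaquettes carrying a system of cuts (`IsKCCutSystem`) the discrete primitive `H` of `X²` exists
  (`exists_kcPrimitive`, by the tree's discrete Poincaré lemma `exists_potential_of_holeFree`) —
  CHI15 Prop. 3.6, first item ("the right-hand side does not depend on the sheet"); (ii) at `β_c`
  the four corner values around a bond are the four projections of one complex number onto the
  four corner lines — CHI21 Remark 2.11 / CHI15 Def. 2.3 — written in the frame of
  `SHolomorphicPrimitive.lean` (`kcVec`, `kcBondVec`, `norm_projLine_kcBondVec_sq_…`): the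
  s-holomorphicity of the critical fermion (CHI21 Lemma 2.12 = CHI15 Prop. 2.4) in the squared form
  consumed by `cornerFlux`.

## Dictionary (tree ↔ CHI21 ↔ CHI15)

Sites of `ℤ²` = CHI21 vertices (spins) = CHI15 faces; plaquettes `faceAt v k` = CHI21 faces
(disorders) = CHI15 vertices; bonds = medial vertices = CHI15 edges; coded corners `(v, k)` = corners
`z` with `z∘ = v`, `z• = faceAt v k`. The tree's corner line `cornerLine v f` spans `i · η_z ℝ` for
CHI21's Dirac spinor `η_z = e^{iπ/4}(z• - z∘)^{-1/2}` (both turn by an eighth-turn from corner to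
corner). CHI15's observable is recovered by the low-temperature expansion:
`F_{[Ω_δ,a;A]}(z) = ± η_z · X_A(z∘, T) / E⁺[σ_a σ_A]` for a cut `T` from the plaquette at `a + δ` to
`z•` (CHI21 Def. 2.8 with `z₁ = a + δ/2`, `σ_{z₁∘} = σ_a` absorbed into `σ_A σ_a`); this
identification is not used in the tree, which takes the Kadanoff–Ceva form as the definition.

## Scope

Everything here is proved; no named facts. Generic in the graph `G` and the boundary condition
where possible (the gauge identity needs a fixed boundary condition and zero field). NOT here: the
global sign bookkeeping (a section of the double cover `[Ω_δ, a]`, i.e. `IsSHolomorphic` of a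
globally defined `F` off a cut), the boundary analysis of `H` (Dirichlet values, modified
Laplacian, CHI15 Prop. 3.6 items 2–4), and all of the convergence theory (CHI15 §3).

## References

* D. Chelkak, C. Hongler, K. Izyurov, *Correlations of primary fields in the critical Ising
  model*, arXiv:2103.10263 (2021): §1.1, §2.2 (Lemmas 2.4, 2.6), §2.3 (Def. 2.8, Def. 2.10,
  Remark 2.11, Lemma 2.12, Def. 2.14) — `ChelkakHonglerIzyurov2021`.
* D. Chelkak, C. Hongler, K. Izyurov, Ann. of Math. 181 (2015) 1087–1138 = arXiv:1202.2838:
  Def. 2.1, Def. 2.3, Prop. 2.4, Lemma 2.6, Remark 2.7, Lemma 3.2, Prop. 3.6 —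
  `ChelkakHonglerIzyurovAnnals2015`.
* L. P. Kadanoff, H. Ceva, Phys. Rev. B 3 (1971) 3918 — `KadanoffCeva1971`.
* S. Smirnov, Ann. of Math. 172 (2010) 1435–1467, Lemma 3.6 — `Smirnov2010`.
-/

noncomputable section

open MeasureTheory Finset

namespace Literature.Probability.LatticeModels

variable {V : Type*} [DecidableEq V] (G : SimpleGraph V) [G.LocallyFinite]

/-! ### Disorder insertions `μ_T = ∏_{e ∈ T} e^{-2β σ_e}` -/

/-- The **disorder insertion** along a finite set `T` of bonds:
`μ_T(σ) = ∏_{e ∈ T} exp (-2β σ_e)`, `σ_{xy} = σ_x σ_y` — the Radon–Nikodym factor which reverses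
the sign of the coupling on every bond of `T` (Kadanoff–Ceva 1971; Chelkak–Hongler–Izyurov 2021,
§1.1 and Lemma 2.4: "`μ_γ = exp[-2β ∑_{(vv') ∩ γ ≠ ∅} σ_v σ_{v'}]`").
[cite: ChelkakHonglerIzyurov2021, §1.1 (definition of μ_γ) and Lemma 2.4; KadanoffCeva1971] -/
def disorderWeight (β : ℝ) (T : Finset (Sym2 V)) (σ : SpinConfig V) : ℝ :=
  ∏ e ∈ T, Real.exp (-2 * β * bondSpin σ e)

omit [DecidableEq V] in
/-- `μ_∅ = 1`. [cite: ChelkakHonglerIzyurov2021, Lemma 2.4] -/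
@[simp] theorem disorderWeight_empty (β : ℝ) (σ : SpinConfig V) : disorderWeight β ∅ σ = 1 := by
  simp [disorderWeight]

omit [DecidableEq V] in
/-- `μ_T > 0`. [cite: ChelkakHonglerIzyurov2021, Lemma 2.4] -/
theorem disorderWeight_pos (β : ℝ) (T : Finset (Sym2 V)) (σ : SpinConfig V) :
    0 < disorderWeight β T σ :=
  prod_pos fun _ _ => Real.exp_pos _

/-- `μ_{T ∪ {e}} = e^{-2βσ_e} μ_T` for `e ∉ T`. [cite: ChelkakHonglerIzyurov2021, Lemma 2.4] -/
theorem disorderWeight_insert (β : ℝ) {T : Finset (Sym2 V)} {e : Sym2 V} (he : e ∉ T)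
    (σ : SpinConfig V) :
    disorderWeight β (insert e T) σ = Real.exp (-2 * β * bondSpin σ e) * disorderWeight β T σ := by
  rw [disorderWeight, prod_insert he, disorderWeight]

omit [DecidableEq V] in
/-- `σ ↦ μ_T(σ)` is measurable. [cite: ChelkakHonglerIzyurov2021, Lemma 2.4] -/
@[fun_prop]
theorem measurable_disorderWeight (β : ℝ) (T : Finset (Sym2 V)) :
    Measurable (disorderWeight (V := V) β T) := by
  unfold disorderWeight
  exact Finset.measurable_prod _ fun e _ =>
    Real.measurable_exp.comp ((measurable_bondSpin e).const_mul _)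

/-- `e^{-2βs} e^{-2β(-s)} = 1`: reversing a coupling twice does nothing. [folklore] -/
theorem exp_coupling_mul_exp_neg (β s : ℝ) :
    Real.exp (-2 * β * s) * Real.exp (-2 * β * -s) = 1 := by
  rw [← Real.exp_add]; convert Real.exp_zero using 2; ring

/-- **The disorder factor is affine in the bond variable**: for `s = ±1`,
`e^{-2βs} = cosh 2β - s sinh 2β`. (Chelkak–Hongler–Izyurov 2021, proof of Lemma 2.12:
"`e^{-2βξ} = cosh(2β) - ξ sinh(2β)`".) [cite: ChelkakHonglerIzyurov2021, proof of Lemma 2.12] -/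
theorem exp_coupling_eq_cosh_sub {s : ℝ} (hs : s = 1 ∨ s = -1) (β : ℝ) :
    Real.exp (-2 * β * s) = Real.cosh (2 * β) - s * Real.sinh (2 * β) := by
  rcases hs with rfl | rfl
  · rw [mul_one, one_mul, Real.cosh_eq, Real.sinh_eq]; ring
  · rw [Real.cosh_eq, Real.sinh_eq, show -2 * β * -1 = 2 * β by ring, show -(2 * β) = -2 * β by ring]
    ring

/-! ### Flipping the spins of `S ⊆ Λ`: the gauge identity -/

/-- The flip on a finite set of sites is a measurable self-map of the configuration space. [folklore] -/
theorem measurable_flipOn (S : Finset V) : Measurable (flipOn (Λ := V) S) := by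
  refine measurable_pi_lambda _ fun v => ?_
  by_cases hv : v ∈ S
  · simp only [flipOn, hv, if_true]
    exact (measurable_of_countable fun u : ℤˣ => -u).comp (measurable_pi_apply v)
  · simp only [flipOn, hv, if_false]
    exact measurable_pi_apply v

omit [DecidableEq V] in
/-- A disorder insertion is the exponential of a coupling sum: `μ_T(σ) = exp(-2β ∑_{e ∈ T} σ_e)`.
[cite: ChelkakHonglerIzyurov2021, Lemma 2.4] -/
theorem disorderWeight_eq_exp_sum (β : ℝ) (T : Finset (Sym2 V)) (σ : SpinConfig V) :
    disorderWeight β T σ = Real.exp (-2 * β * ∑ e ∈ T, bondSpin σ e) := by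
  rw [disorderWeight, mul_sum, Real.exp_sum]

/-- **The Boltzmann weight after flipping `S ⊆ Λ`** (fixed boundary condition, zero field):
`w(σ^S) = w(σ) μ_{∂S}(σ)` — flipping `S` reverses exactly the boundary bonds of `S`
(`isingHamiltonian_sub_isingHamiltonian_flipOn`). [cite: ChelkakHonglerIzyurov2021, Lemma 2.4 (proof)] -/
theorem isingWeight_flipOnFin {Λ S : Finset V} (hS : S ⊆ Λ) (β : ℝ) (η : SpinConfig V) (τ : Λ → ℤˣ) :
    isingWeight G Λ β 0 (.fixed η) (flipOnFin Λ S τ) =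
      isingWeight G Λ β 0 (.fixed η) τ * disorderWeight β (edgeBoundary G S) (glue Λ τ (.fixed η)) := by
  rw [isingWeight, isingWeight, glue_flipOnFin hS, disorderWeight_eq_exp_sum, ← Real.exp_add]
  congr 1
  have h := isingHamiltonian_sub_isingHamiltonian_flipOn G hS 0 η (glue Λ τ (.fixed η))
  simp only [zero_mul, mul_zero, sub_zero] at h
  linear_combination β * h

/-- **Gauge identity** (change of variables `σ ↦ σ^S` in the finite-volume Gibbs average, fixed
boundary condition `η`, zero field, `S ⊆ Λ`): `⟨f ∘ flip_S⟩ = ⟨μ_{∂S} · f⟩`. This is the content of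
Chelkak–Hongler–Izyurov 2021, Lemma 2.4 ("this bijection preserves weights, except that the
contribution of the edges intersecting `γ` to the energy comes with the opposite sign").
[cite: ChelkakHonglerIzyurov2021, Lemma 2.4] -/
theorem isingExpect_comp_flipOn {Λ S : Finset V} (hS : S ⊆ Λ) (β : ℝ) (η : SpinConfig V)
    {f : SpinConfig V → ℝ} (hf : Measurable f) :
    isingExpect G Λ β 0 (.fixed η) (fun σ => f (flipOn S σ)) =
      isingExpect G Λ β 0 (.fixed η) (fun σ => disorderWeight β (edgeBoundary G S) σ * f σ) := by
  rw [isingExpect_eq_sum_div G Λ 0 _ β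
      (show Measurable (fun σ => f (flipOn S σ)) from hf.comp (measurable_flipOn S)),
    isingExpect_eq_sum_div G Λ 0 _ β
      (show Measurable (fun σ => disorderWeight β (edgeBoundary G S) σ * f σ) from
        (measurable_disorderWeight β _).mul hf)]
  congr 1
  -- reindex the left sum by the involution `τ ↦ τ^S`
  have hinv : Function.Involutive (flipOnFin Λ S) := flipOnFin_flipOnFin Λ S
  symm
  refine Fintype.sum_equiv hinv.toPerm _ _ fun τ => ?_
  rw [Function.Involutive.coe_toPerm, isingWeight_flipOnFin G hS,
    glue_flipOnFin hS, flipOn_involutive S (glue Λ τ (.fixed η))]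
  ring

/-- Pointwise bookkeeping for the disorder insertions under a flip of `S`: for a set `T` of bonds
of `G`, `μ_{∂S}(σ) · μ_{T ∆ ∂S}(σ^S) = μ_T(σ)` — bonds of `T ∖ ∂S` keep their value under the flip,
bonds of `∂S ∖ T` are reversed and cancel against `μ_{∂S}`. [cite: ChelkakHonglerIzyurov2021, Lemma 2.4 (proof)] -/
theorem disorderWeight_mul_disorderWeight_symmDiff_flipOn (β : ℝ) {Λ : Finset V} (S : Finset V)
    {T : Finset (Sym2 V)} (hT : T ⊆ edgesTouching G Λ) (σ : SpinConfig V) :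
    disorderWeight β (edgeBoundary G S) σ * disorderWeight β (symmDiff T (edgeBoundary G S)) (flipOn S σ) =
      disorderWeight β T σ := by
  set B := edgeBoundary G S with hB
  -- split `T ∆ B = (T \ B) ∪ (B \ T)` and `B = (B ∩ T) ∪ (B \ T)`, `T = (T \ B) ∪ (B ∩ T)`
  have hdisj1 : Disjoint (T \ B) (B \ T) := by
    rw [Finset.disjoint_left]; intro e he he'
    exact (mem_sdiff.1 he').2 (mem_sdiff.1 he).1
  have hsd : symmDiff T B = (T \ B) ∪ (B \ T) := rfl
  have hflipT : ∀ e ∈ T \ B, bondSpin (flipOn S σ) e = bondSpin σ e := fun e he =>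
    bondSpin_flipOn_of_not_mem_edgeBoundary G σ (hT (mem_sdiff.1 he).1) (mem_sdiff.1 he).2
  have hflipB : ∀ e ∈ B \ T, bondSpin (flipOn S σ) e = -bondSpin σ e := fun e he =>
    bondSpin_flipOn_of_mem_edgeBoundary G σ (mem_sdiff.1 he).1
  have h1 : disorderWeight β (symmDiff T B) (flipOn S σ) =
      (∏ e ∈ T \ B, Real.exp (-2 * β * bondSpin σ e)) *
        ∏ e ∈ B \ T, Real.exp (-2 * β * -bondSpin σ e) := by
    rw [disorderWeight, hsd, prod_union hdisj1]
    congr 1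
    · exact prod_congr rfl fun e he => by rw [hflipT e he]
    · exact prod_congr rfl fun e he => by rw [hflipB e he]
  have h2 : disorderWeight β B σ =
      (∏ e ∈ B ∩ T, Real.exp (-2 * β * bondSpin σ e)) * ∏ e ∈ B \ T, Real.exp (-2 * β * bondSpin σ e) := by
    have hsplit : B = (B ∩ T) ∪ (B \ T) := by
      ext e; simp only [mem_union, mem_inter, mem_sdiff]; tauto
    have hd : Disjoint (B ∩ T) (B \ T) :=
      Finset.disjoint_left.2 fun e he he' => (mem_sdiff.1 he').2 (mem_inter.1 he).2
    rw [disorderWeight, ← prod_union hd, ← hsplit]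
  have h3 : disorderWeight β T σ =
      (∏ e ∈ T \ B, Real.exp (-2 * β * bondSpin σ e)) * ∏ e ∈ B ∩ T, Real.exp (-2 * β * bondSpin σ e) := by
    have hsplit : T = (T \ B) ∪ (B ∩ T) := by
      ext e; simp only [mem_union, mem_sdiff, mem_inter]; tauto
    have hd : Disjoint (T \ B) (B ∩ T) :=
      Finset.disjoint_left.2 fun e he he' => (mem_sdiff.1 he).2 (mem_inter.1 he').1
    rw [disorderWeight, ← prod_union hd, ← hsplit]
  have h4 : (∏ e ∈ B \ T, Real.exp (-2 * β * bondSpin σ e)) *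
      ∏ e ∈ B \ T, Real.exp (-2 * β * -bondSpin σ e) = 1 := by
    rw [← prod_mul_distrib]
    exact prod_eq_one fun e _ => exp_coupling_mul_exp_neg β _
  rw [h1, h2, h3]
  linear_combination
    (∏ e ∈ B ∩ T, Real.exp (-2 * β * bondSpin σ e)) * (∏ e ∈ T \ B, Real.exp (-2 * β * bondSpin σ e)) * h4

/-- **Moving the branch cut** (Chelkak–Hongler–Izyurov 2021, Lemma 2.4 and the discussion before
Lemma 2.6: "taking the symmetric difference of `γ` and the edge …"; here for a whole site set `S`
at once): for `S ⊆ Λ` and a set `T` of bonds of `G` touching `Λ`,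
`⟨μ_{T ∆ ∂S} · (g ∘ flip_S)⟩ = ⟨μ_T · g⟩`. With `g = σ_B` this is the sign rule
`⟨μ_{T ∆ ∂S} σ_B⟩ = (-1)^{|B ∩ S|} ⟨μ_T σ_B⟩` (`isingExpect_disorder_symmDiff_spinProduct`).
[cite: ChelkakHonglerIzyurov2021, Lemma 2.4] -/
theorem isingExpect_disorder_symmDiff {Λ S : Finset V} (hS : S ⊆ Λ) (β : ℝ) (η : SpinConfig V)
    {T : Finset (Sym2 V)} (hT : T ⊆ edgesTouching G Λ) {g : SpinConfig V → ℝ} (hg : Measurable g) :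
    isingExpect G Λ β 0 (.fixed η)
        (fun σ => disorderWeight β (symmDiff T (edgeBoundary G S)) σ * g (flipOn S σ)) =
      isingExpect G Λ β 0 (.fixed η) (fun σ => disorderWeight β T σ * g σ) := by
  -- apply the gauge identity to `f = (μ_{T ∆ ∂S} ∘ flip_S) · g`
  have hf : Measurable fun σ => disorderWeight β (symmDiff T (edgeBoundary G S)) (flipOn S σ) * g σ :=
    ((measurable_disorderWeight β _).comp (measurable_flipOn S)).mul hg
  have h := isingExpect_comp_flipOn G hS β η hf
  have hinv := flipOn_involutive (Λ := V) S
  simp only [hinv _] at h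
  rw [h]
  congr 1
  funext σ
  rw [← mul_assoc, disorderWeight_mul_disorderWeight_symmDiff_flipOn G β S hT σ]

/-- **Sign rule for moving the branch cut across spins** (Chelkak–Hongler–Izyurov 2021, Lemma 2.4
with Lemma 2.6: the correlation "picks a `-1` sign every time a spin … winds around a disorder"):
`⟨μ_{T ∆ ∂S} σ_B⟩^η_Λ = (-1)^{|B ∩ S|} ⟨μ_T σ_B⟩^η_Λ` for `S ⊆ Λ`, `T` bonds of `G` touching `Λ`.
[cite: ChelkakHonglerIzyurov2021, Lemmas 2.4 and 2.6] -/
theorem isingExpect_disorder_symmDiff_spinProduct {Λ S : Finset V} (hS : S ⊆ Λ) (β : ℝ)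
    (η : SpinConfig V) {T : Finset (Sym2 V)} (hT : T ⊆ edgesTouching G Λ) (B : Finset V) :
    isingExpect G Λ β 0 (.fixed η) (fun σ => disorderWeight β (symmDiff T (edgeBoundary G S)) σ * spinProduct B σ) =
      (-1) ^ #(B ∩ S) *
        isingExpect G Λ β 0 (.fixed η) (fun σ => disorderWeight β T σ * spinProduct B σ) := by
  have h := isingExpect_disorder_symmDiff G hS β η hT
    (g := fun σ => (-1 : ℝ) ^ #(B ∩ S) * spinProduct B σ) ((measurable_spinProduct B).const_mul _)
  have h1 : (fun σ => disorderWeight β (symmDiff T (edgeBoundary G S)) σ *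
      ((-1 : ℝ) ^ #(B ∩ S) * spinProduct B (flipOn S σ))) =
      fun σ => disorderWeight β (symmDiff T (edgeBoundary G S)) σ * spinProduct B σ := by
    funext σ
    rw [spinProduct_flipOn S B σ, ← mul_assoc ((-1 : ℝ) ^ _), ← pow_add, ← two_mul, pow_mul]
    norm_num
  rw [h1] at h
  rw [h, ← isingExpect_const_mul' G Λ 0 _ β _ (f := fun σ => disorderWeight β T σ * spinProduct B σ)
    ((measurable_disorderWeight β T).mul (measurable_spinProduct B))]
  exact congrArg _ (funext fun σ => by ring)

/-! ### Kadanoff–Ceva corner values and the propagation identity -/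

/-- The **Kadanoff–Ceva corner value** `X_B(v, T) = ⟨μ_T σ_v σ_B⟩^{bc}_{Λ;β}`: the correlation of
the disorder insertion `μ_T` (a branch cut `T` ending at the plaquette of the corner), the spin at
the site `v` of the corner, and the background spins `σ_B`. Up to the phase `η_z` and the
normalisation this is the value at the corner `z = (v, ·)` of the fermionic observable of
Chelkak–Hongler–Izyurov 2021, Def. 2.8 (`F(z₁,z) = η_{z₁} η_z E[μ_{z₁•} μ_{z•} σ_{z₁∘} σ_{z∘} σ_B]/E[σ_B]`,
the two disorders being `μ_T` for a cut `T` from `z₁•` to `z•`), and — by the low-temperature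
expansion — of the spinor observable `F_{[Ω_δ,a;A]}(z)` of Chelkak–Hongler–Izyurov 2015, Def. 2.1,
for `B = A`, `T` a cut from the plaquette at `a + δ` to `z•`, normalised by `E[σ_a σ_A]`.
[cite: ChelkakHonglerIzyurov2021, Def. 2.8; ChelkakHonglerIzyurovAnnals2015, Def. 2.1] -/
def kcCorner (Λ : Finset V) (β : ℝ) (bc : BoundaryCondition V) (B : Finset V) (T : Finset (Sym2 V))
    (v : V) : ℝ :=
  isingExpect G Λ β 0 bc (fun σ => disorderWeight β T σ * (spinAt v σ * spinProduct B σ))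

omit [DecidableEq V] in
/-- The integrand of a corner value is measurable. [folklore] -/
theorem measurable_kcIntegrand (β : ℝ) (B : Finset V) (T : Finset (Sym2 V)) (v : V) :
    Measurable fun σ : SpinConfig V => disorderWeight β T σ * (spinAt v σ * spinProduct B σ) :=
  (measurable_disorderWeight β T).mul ((measurable_spinAt v).mul (measurable_spinProduct B))

/-- **The propagation identity, pointwise** (Chelkak–Hongler–Izyurov 2021, proof of Lemma 2.12):
across the bond `e = {u, u'}`,
`μ_{T ∪ {e}} σ_u = e^{-2βσ_uσ_{u'}} μ_T σ_u = cosh(2β) μ_T σ_u - sinh(2β) μ_T σ_{u'}`.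
[cite: ChelkakHonglerIzyurov2021, Lemma 2.12 (proof)] -/
theorem disorderWeight_insert_mul_spinAt (β : ℝ) {T : Finset (Sym2 V)} {u u' : V}
    (he : s(u, u') ∉ T) (σ : SpinConfig V) (g : ℝ) :
    disorderWeight β (insert s(u, u') T) σ * (spinAt u σ * g) =
      Real.cosh (2 * β) * (disorderWeight β T σ * (spinAt u σ * g)) -
        Real.sinh (2 * β) * (disorderWeight β T σ * (spinAt u' σ * g)) := by
  rw [disorderWeight_insert β he, exp_coupling_eq_cosh_sub (bondSpin_eq_one_or σ s(u, u')) β, bondSpin_mk]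
  have h1 : spinAt u σ * spinAt u σ = 1 := spinAt_mul_self u σ
  linear_combination (-(Real.sinh (2 * β) * disorderWeight β T σ * spinAt u' σ * g)) * h1

/-- **The propagation identity for Kadanoff–Ceva corner values** (the computation proving
Chelkak–Hongler–Izyurov 2021, Lemma 2.12, written at general `β`): for a bond `e = {u, u'} ∉ T`,
`X(u, T ∪ {e}) = cosh(2β) X(u, T) - sinh(2β) X(u', T)`. Valid for every graph, volume and boundary
condition (it is linearity of the Gibbs average). [cite: ChelkakHonglerIzyurov2021, Lemma 2.12] -/
theorem kcCorner_insert (Λ : Finset V) (β : ℝ) (bc : BoundaryCondition V) (B : Finset V)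
    {T : Finset (Sym2 V)} {u u' : V} (he : s(u, u') ∉ T) :
    kcCorner G Λ β bc B (insert s(u, u') T) u =
      Real.cosh (2 * β) * kcCorner G Λ β bc B T u - Real.sinh (2 * β) * kcCorner G Λ β bc B T u' := by
  unfold kcCorner
  have hfun : (fun σ => disorderWeight β (insert s(u, u') T) σ * (spinAt u σ * spinProduct B σ)) =
      fun σ => Real.cosh (2 * β) * (disorderWeight β T σ * (spinAt u σ * spinProduct B σ)) +
        (-Real.sinh (2 * β)) * (disorderWeight β T σ * (spinAt u' σ * spinProduct B σ)) := by
    funext σ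
    rw [disorderWeight_insert_mul_spinAt β he]
    ring
  rw [hfun, isingExpect_add' G Λ 0 bc β ((measurable_kcIntegrand β B T u).const_mul _)
      ((measurable_kcIntegrand β B T u').const_mul _),
    isingExpect_const_mul' G Λ 0 bc β _ (measurable_kcIntegrand β B T u),
    isingExpect_const_mul' G Λ 0 bc β _ (measurable_kcIntegrand β B T u')]
  ring

/-- The propagation identity read from the other end of the bond:
`X(u', T ∪ {e}) = cosh(2β) X(u', T) - sinh(2β) X(u, T)`. [cite: ChelkakHonglerIzyurov2021, Lemma 2.12] -/
theorem kcCorner_insert' (Λ : Finset V) (β : ℝ) (bc : BoundaryCondition V) (B : Finset V)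
    {T : Finset (Sym2 V)} {u u' : V} (he : s(u, u') ∉ T) :
    kcCorner G Λ β bc B (insert s(u, u') T) u' =
      Real.cosh (2 * β) * kcCorner G Λ β bc B T u' - Real.sinh (2 * β) * kcCorner G Λ β bc B T u := by
  rw [Sym2.eq_swap] at he ⊢
  exact kcCorner_insert G Λ β bc B he

/-- **The flux form `X²` is closed around every bond** — the algebraic reason why the discrete
primitive `H = Re ∫ F²` of Chelkak–Hongler–Izyurov 2015, Prop. 3.6 (`H°(w) - H•(v) = 2δ |F(½(w+v))|²`
across the corner between the face `w` and the vertex `v`; Smirnov 2010, Lemma 3.6) is well defined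
around an edge: the squared corner values of the two diagonal pairs of corners of a bond
`e = {u, u'}` have equal sums, `X(u,T)² + X(u',T ∪ e)² = X(u',T)² + X(u,T ∪ e)²`. It holds at every
`β` (`cosh² - sinh² = 1`). [cite: ChelkakHonglerIzyurovAnnals2015, Prop. 3.6; Smirnov2010, Lemma 3.6] -/
theorem kcCorner_sq_add_sq (Λ : Finset V) (β : ℝ) (bc : BoundaryCondition V) (B : Finset V)
    {T : Finset (Sym2 V)} {u u' : V} (he : s(u, u') ∉ T) :
    kcCorner G Λ β bc B T u ^ 2 + kcCorner G Λ β bc B (insert s(u, u') T) u' ^ 2 =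
      kcCorner G Λ β bc B T u' ^ 2 + kcCorner G Λ β bc B (insert s(u, u') T) u ^ 2 := by
  rw [kcCorner_insert G Λ β bc B he, kcCorner_insert' G Λ β bc B he]
  have h := Real.cosh_sq_sub_sinh_sq (2 * β)
  linear_combination (kcCorner G Λ β bc B T u' ^ 2 - kcCorner G Λ β bc B T u ^ 2) * h

/-! ### The critical point of the square lattice: `cosh 2β_c = √2`, `sinh 2β_c = 1` -/

/-- `cosh (2β_c) = √2` at the self-dual point `β_c = ½ log (1 + √2)` of the square lattice
(`sinh (2β_c) = 1`, `cosh² = 1 + sinh²`). (Onsager 1944; Chelkak–Hongler–Izyurov 2021, eq. (2.1) and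
proof of Lemma 2.12: "`e^{-2βξ} = √2 - ξ`".) [cite: ChelkakHonglerIzyurov2021, Lemma 2.12 (proof)] -/
theorem cosh_two_mul_criticalBetaTwo : Real.cosh (2 * criticalBetaTwo) = Real.sqrt 2 := by
  have h1 : Real.cosh (2 * criticalBetaTwo) ^ 2 = 2 := by
    rw [Real.cosh_sq, sinh_two_mul_criticalBetaTwo]; norm_num
  have h2 : 0 < Real.cosh (2 * criticalBetaTwo) := Real.cosh_pos _
  rw [← Real.sqrt_sq h2.le, h1]

/-- **The critical propagation identity** (Chelkak–Hongler–Izyurov 2021, Lemma 2.12): at `β = β_c`,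
`X(u, T ∪ {e}) = √2 X(u, T) - X(u', T)` across the bond `e = {u, u'} ∉ T`.
[cite: ChelkakHonglerIzyurov2021, Lemma 2.12] -/
theorem kcCorner_insert_critical (Λ : Finset V) (bc : BoundaryCondition V) (B : Finset V)
    {T : Finset (Sym2 V)} {u u' : V} (he : s(u, u') ∉ T) :
    kcCorner G Λ criticalBetaTwo bc B (insert s(u, u') T) u =
      Real.sqrt 2 * kcCorner G Λ criticalBetaTwo bc B T u - kcCorner G Λ criticalBetaTwo bc B T u' := by
  rw [kcCorner_insert G Λ _ bc B he, cosh_two_mul_criticalBetaTwo, sinh_two_mul_criticalBetaTwo, one_mul]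

/-- The critical propagation identity from the other end: `X(u', T ∪ {e}) = √2 X(u', T) - X(u, T)`.
[cite: ChelkakHonglerIzyurov2021, Lemma 2.12] -/
theorem kcCorner_insert_critical' (Λ : Finset V) (bc : BoundaryCondition V) (B : Finset V)
    {T : Finset (Sym2 V)} {u u' : V} (he : s(u, u') ∉ T) :
    kcCorner G Λ criticalBetaTwo bc B (insert s(u, u') T) u' =
      Real.sqrt 2 * kcCorner G Λ criticalBetaTwo bc B T u' - kcCorner G Λ criticalBetaTwo bc B T u := by
  rw [kcCorner_insert' G Λ _ bc B he, cosh_two_mul_criticalBetaTwo, sinh_two_mul_criticalBetaTwo, one_mul]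

/-! ### Moving the cut, frozen sites, and the empty cut -/

/-- **Moving the branch cut of a corner value** (monodromy): for `S ⊆ Λ`,
`X_B(v, T ∆ ∂S) = (-1)^{|(B ∆ {v}) ∩ S|} X_B(v, T)` — the corner value changes sign each time the
cut is dragged across the site `v` of the corner or across a background spin
(Chelkak–Hongler–Izyurov 2021, Lemma 2.6 / Lemma 2.9: the observable "is a spinor … ramified over
`v`, `z∘`"). [cite: ChelkakHonglerIzyurov2021, Lemmas 2.4, 2.6, 2.9] -/
theorem kcCorner_symmDiff_edgeBoundary {Λ S : Finset V} (hS : S ⊆ Λ) (β : ℝ) (η : SpinConfig V)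
    (B : Finset V) {T : Finset (Sym2 V)} (hT : T ⊆ edgesTouching G Λ) (v : V) :
    kcCorner G Λ β (.fixed η) B (symmDiff T (edgeBoundary G S)) v =
      (-1) ^ #(symmDiff B {v} ∩ S) * kcCorner G Λ β (.fixed η) B T v := by
  have hprod : ∀ σ : SpinConfig V, spinAt v σ * spinProduct B σ = spinProduct (symmDiff B {v}) σ := by
    intro σ
    classical
    by_cases hv : v ∈ B
    · have h1 : symmDiff B {v} = B.erase v := by
        ext x; simp only [Finset.mem_symmDiff, mem_singleton, mem_erase]
        constructor
        · rintro (⟨hx, hxv⟩ | ⟨rfl, hx⟩); · exact ⟨hxv, hx⟩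
          · exact absurd hv hx
        · rintro ⟨hxv, hx⟩; exact Or.inl ⟨hx, hxv⟩
      rw [h1, spinProduct, spinProduct, ← mul_prod_erase B _ hv, ← mul_assoc, spinAt_mul_self, one_mul]
    · have h1 : symmDiff B {v} = insert v B := by
        ext x; simp only [Finset.mem_symmDiff, mem_singleton, mem_insert]
        constructor
        · rintro (⟨hx, -⟩ | ⟨rfl, -⟩); · exact Or.inr hx
          · exact Or.inl rfl
        · rintro (rfl | hx); · exact Or.inr ⟨rfl, hv⟩
          · exact Or.inl ⟨hx, fun h => hv (h ▸ hx)⟩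
      rw [h1, spinProduct, spinProduct, prod_insert hv]
  unfold kcCorner
  simp only [hprod]
  exact isingExpect_disorder_symmDiff_spinProduct G hS β η hT _

/-- **Corner values at frozen sites** (fixed boundary condition `η`): for `v ∉ Λ` the spin `σ_v`
is the boundary value, `X_B(v, T) = η_v ⟨μ_T σ_B⟩`. For the `+` condition all corners of a
boundary plaquette at its frozen sites therefore carry the same value `⟨μ_T σ_B⟩` — the lattice
form of the boundary condition (2.4) of Chelkak–Hongler–Izyurov 2015, Prop. 2.4 /
Chelkak–Hongler–Izyurov 2021, Def. 2.14 (1). [cite: ChelkakHonglerIzyurovAnnals2015, Prop. 2.4; ChelkakHonglerIzyurov2021, Def. 2.14] -/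
theorem kcCorner_of_notMem (Λ : Finset V) (β : ℝ) (η : SpinConfig V) (B : Finset V)
    (T : Finset (Sym2 V)) {v : V} (hv : v ∉ Λ) :
    kcCorner G Λ β (.fixed η) B T v =
      spinAt v η * isingExpect G Λ β 0 (.fixed η) (fun σ => disorderWeight β T σ * spinProduct B σ) := by
  unfold kcCorner
  rw [isingExpect_eq_sum_div G Λ 0 _ β (measurable_kcIntegrand β B T v),
    isingExpect_eq_sum_div G Λ 0 _ β
      (show Measurable (fun σ => disorderWeight β T σ * spinProduct B σ) from
        (measurable_disorderWeight β T).mul (measurable_spinProduct B)),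
    mul_div_assoc', mul_sum]
  congr 1
  refine sum_congr rfl fun τ _ => ?_
  have h : spinAt v (glue Λ τ (.fixed η)) = spinAt v η := by
    rw [spinAt, spinAt, glue_apply_of_notMem Λ τ _ hv, BoundaryCondition.outside_fixed]
  rw [h]; ring

/-- Frozen `+` sites: `X_B(v, T) = ⟨μ_T σ_B⟩⁺` for `v ∉ Λ`. [cite: ChelkakHonglerIzyurovAnnals2015, Prop. 2.4 (boundary condition (2.4))] -/
theorem kcCorner_plus_of_notMem (Λ : Finset V) (β : ℝ) (B : Finset V) (T : Finset (Sym2 V))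
    {v : V} (hv : v ∉ Λ) :
    kcCorner G Λ β .plus B T v =
      isingExpect G Λ β 0 .plus (fun σ => disorderWeight β T σ * spinProduct B σ) := by
  rw [BoundaryCondition.plus, kcCorner_of_notMem G Λ β 1 B T hv]
  simp [spinAt]

/-- **The empty cut: corner values next to the source are plain spin correlations**
(Chelkak–Hongler–Izyurov 2015, Lemma 2.6, eq. (2.3), and Remark 2.7: the values of
`F_{[Ω_δ,a;A]}` at the three corners of the plaquette at `a + δ` other than the source corner are
`E[σ_{a+2δ}σ_A]/E[σ_aσ_A]` and `e^{∓iπ/4} E[σ_{a+(1±i)δ}σ_A]/E[σ_aσ_A]` — no disorder is inserted):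
`X_B(v, ∅) = ⟨σ_v σ_B⟩`. [cite: ChelkakHonglerIzyurovAnnals2015, Lemma 2.6 and Remark 2.7] -/
theorem kcCorner_empty (Λ : Finset V) (β : ℝ) (bc : BoundaryCondition V) (B : Finset V) (v : V) :
    kcCorner G Λ β bc B ∅ v = isingExpect G Λ β 0 bc (fun σ => spinAt v σ * spinProduct B σ) := by
  simp [kcCorner]

/-- The empty cut with the site off the background set: `X_B(v, ∅) = ⟨σ_{B ∪ {v}}⟩` for `v ∉ B`.
[cite: ChelkakHonglerIzyurovAnnals2015, Lemma 2.6] -/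
theorem kcCorner_empty_of_notMem (Λ : Finset V) (β : ℝ) (bc : BoundaryCondition V) {B : Finset V}
    {v : V} (hv : v ∉ B) : kcCorner G Λ β bc B ∅ v = isingCorr G Λ β 0 bc (insert v B) := by
  rw [kcCorner_empty, isingCorr]
  congr 1
  funext σ
  rw [spinProduct, spinProduct, prod_insert hv]

/-- The empty cut at a background site: `X_B(v, ∅) = ⟨σ_{B ∖ {v}}⟩` for `v ∈ B` (`σ_v² = 1`); at the
source corner itself (`v = a ∈ B`) this is the "discrete singularity" of the observable
(Chelkak–Hongler–Izyurov 2015, Lemma 3.2 and the paragraph before it). [cite: ChelkakHonglerIzyurovAnnals2015, Lemma 3.2] -/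
theorem kcCorner_empty_of_mem (Λ : Finset V) (β : ℝ) (bc : BoundaryCondition V) {B : Finset V}
    {v : V} (hv : v ∈ B) : kcCorner G Λ β bc B ∅ v = isingCorr G Λ β 0 bc (B.erase v) := by
  rw [kcCorner_empty, isingCorr]
  congr 1
  funext σ
  rw [spinProduct, spinProduct, ← mul_prod_erase B _ hv, ← mul_assoc, spinAt_mul_self, one_mul]

/-! ### Closedness of the flux form under a change of cut -/

/-- `T ∆ {e} = T ∪ {e}` for `e ∉ T`. [folklore] -/
private theorem symmDiff_singleton_of_notMem {α : Type*} [DecidableEq α] {T : Finset α} {e : α} (he : e ∉ T) :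
    symmDiff T {e} = insert e T := by
  ext x
  simp only [Finset.mem_symmDiff, mem_singleton, mem_insert]
  constructor
  · rintro (⟨hx, -⟩ | ⟨rfl, -⟩); · exact Or.inr hx
    · exact Or.inl rfl
  · rintro (rfl | hx); · exact Or.inr ⟨rfl, he⟩
    · exact Or.inl ⟨hx, fun h => he (h ▸ hx)⟩

/-- `T ∆ {e} = T ∖ {e}` for `e ∈ T` (cf. `symmDiff_singleton_eq_erase` in `TreeGraphWickTuples.lean`;
a local copy keeps the import closure small). [folklore] -/
private theorem symmDiff_singleton_of_mem {α : Type*} [DecidableEq α] {T : Finset α} {e : α} (he : e ∈ T) :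
    symmDiff T {e} = T.erase e := by
  ext x
  simp only [Finset.mem_symmDiff, mem_singleton, mem_erase]
  constructor
  · rintro (⟨hx, hxe⟩ | ⟨rfl, hx⟩); · exact ⟨hxe, hx⟩
    · exact absurd he hx
  · rintro ⟨hxe, hx⟩; exact Or.inl ⟨hx, hxe⟩

/-- **The flux form is closed around a bond for any admissible change of cut.** If the cut `T'`
used at the plaquette on one side of the bond `e = {u, u'}` differs from the cut `T` used on the
other side by `e` itself and by a gauge move `∂S`, `S ⊆ Λ` (this is how the two branch cuts ending
at the two plaquettes of an edge are related, Chelkak–Hongler–Izyurov 2021, proof of Lemma 2.12: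
"as `z` moves from `z_E` to `z_S`, we must append `γ` with `e•`"), then
`X(u,T)² + X(u',T')² = X(u',T)² + X(u,T')²`: the squared corner values — which do not see the sign
of the gauge move — add up consistently around the bond (Chelkak–Hongler–Izyurov 2015, Prop. 3.6:
"the right-hand side of (3.4) does not depend on the sheet"). [cite: ChelkakHonglerIzyurovAnnals2015, Prop. 3.6; ChelkakHonglerIzyurov2021, Lemma 2.12] -/
theorem kcCorner_sq_cycle {Λ S : Finset V} (hS : S ⊆ Λ) (β : ℝ) (η : SpinConfig V) (B : Finset V)
    {T : Finset (Sym2 V)} (hT : T ⊆ edgesTouching G Λ) {u u' : V}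
    (he : s(u, u') ∈ edgesTouching G Λ) :
    kcCorner G Λ β (.fixed η) B T u ^ 2 +
        kcCorner G Λ β (.fixed η) B (symmDiff (symmDiff T {s(u, u')}) (edgeBoundary G S)) u' ^ 2 =
      kcCorner G Λ β (.fixed η) B T u' ^ 2 +
        kcCorner G Λ β (.fixed η) B (symmDiff (symmDiff T {s(u, u')}) (edgeBoundary G S)) u ^ 2 := by
  set T₁ := symmDiff T {s(u, u')} with hT₁
  have hT₁sub : T₁ ⊆ edgesTouching G Λ := by
    intro x hx
    rcases (Finset.mem_symmDiff.1 hx) with ⟨hxT, -⟩ | ⟨hxe, -⟩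
    · exact hT hxT
    · rw [mem_singleton.1 hxe]; exact he
  -- the gauge move does not change the squares
  have hsq : ∀ v, kcCorner G Λ β (.fixed η) B (symmDiff T₁ (edgeBoundary G S)) v ^ 2 =
      kcCorner G Λ β (.fixed η) B T₁ v ^ 2 := by
    intro v
    rw [kcCorner_symmDiff_edgeBoundary G hS β η B hT₁sub v, mul_pow, ← pow_mul, mul_comm _ 2, pow_mul,
      neg_one_sq, one_pow, one_mul]
  rw [hsq, hsq]
  by_cases heT : s(u, u') ∈ T
  · -- `T = T₁ ∪ {e}` with `e ∉ T₁`
    have hT₁e : T₁ = T.erase s(u, u') := symmDiff_singleton_of_mem heT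
    have hnot : s(u, u') ∉ T₁ := by rw [hT₁e]; exact notMem_erase _ _
    have hins : insert s(u, u') T₁ = T := by rw [hT₁e, insert_erase heT]
    have h := kcCorner_sq_add_sq G Λ β (.fixed η) B hnot
    rw [hins] at h
    linear_combination -h
  · have hT₁e : T₁ = insert s(u, u') T := symmDiff_singleton_of_notMem heT
    rw [hT₁e]
    exact kcCorner_sq_add_sq G Λ β (.fixed η) B heT

/-! ### The complex value at a bond: Chelkak–Hongler–Izyurov's Remark 2.11 in the tree's frame

The tree measures corner lines in the frame of `SHolomorphicPrimitive.lean`: the line of the coded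
corner `(v, k)` is spanned by `η₀ (1 - i)ⁿ` for any `n ≡ k (mod 4)` (`cornerLine_eq_frame`), and
projections onto it are read through `Re(frameCoord X · (1 + i)ⁿ)` (`projLine_cornerLine_eq_iff`,
`norm_projLine_cornerLine_sq`). The four corners of the bond `e = {x, x + cornerUnit k}` are the
coded corners `(x, k)`, `(x + cornerUnit k, k + 1)` (at the plaquette `faceAt x k`,
`faceAt_add_unit_succ`) and `(x, k + 3)`, `(x + cornerUnit k, k + 2)` (at the plaquette
`faceAt x (k + 3)`, `faceAt_add_unit_add_two`); their lines are the frame lines `n, n + 1, n + 3, n + 2`,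
two orthogonal pairs `{n, n + 2}`, `{n + 1, n + 3}` (Chelkak–Hongler–Izyurov 2021, Remark 2.11:
"`η_{z_N} ℝ = i η_{z_S} ℝ` and `η_{z_E} ℝ = i η_{z_W} ℝ`"). -/

section Frame

open Complex ComplexConjugate

/-- The length `N_n = ‖η₀ (1 - i)ⁿ‖ = (√2 · 2ⁿ)^{1/2}` of the `n`-th frame vector. [folklore] -/
def frameNorm (v₀ : Site 2) (n : ℕ) : ℝ := ‖frameVec v₀ * (1 - I) ^ n‖

/-- `N_n > 0`. [folklore] -/
theorem frameNorm_pos (v₀ : Site 2) (n : ℕ) : 0 < frameNorm v₀ n :=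
  norm_pos_iff.2 (frameVec_mul_pow_ne_zero v₀ n)

/-- `N_n² = √2 · 2ⁿ`. [folklore] -/
theorem frameNorm_sq (v₀ : Site 2) (n : ℕ) : frameNorm v₀ n ^ 2 = Real.sqrt 2 * 2 ^ n :=
  norm_frameVec_mul_pow_sq v₀ n

/-- **The complex value attached to a bond from two opposite corner values** (Chelkak–Hongler–Izyurov
2021, Remark 2.11: "the existence of a complex number `F(e)` such that `F(z) = Proj_{η_z}[F(e)]`,
`z = z_N, z_W, z_S, z_E`"; Chelkak–Hongler–Izyurov 2015, Def. 2.3): the vector whose projections onto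
the orthogonal frame lines `n` and `n + 2` have signed lengths `a` and `d`,
`(a - d i) · η₀(1 - i)ⁿ / N_n`. [cite: ChelkakHonglerIzyurov2021, Remark 2.11] -/
def kcVec (v₀ : Site 2) (n : ℕ) (a d : ℝ) : ℂ :=
  ((a : ℂ) - d * I) * (frameVec v₀ * (1 - I) ^ n) / (frameNorm v₀ n : ℂ)

/-- `(1 - i)ⁿ (1 + i)ⁿ = 2ⁿ`. [folklore] -/
theorem one_sub_I_pow_mul_one_add_I_pow (n : ℕ) : (1 - I) ^ n * (1 + I) ^ n = (2 : ℂ) ^ n := by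
  rw [← mul_pow]
  congr 1
  rw [mul_comm, ← sq_sub_sq, one_pow, I_sq]; ring

/-- **Frame coordinates of the bond value**: for every `j`,
`frameCoord (kcVec n a d) · (1 + i)^{n + j} = (a - d i) · N_n · (1 + i)^j`. [cite: ChelkakHonglerIzyurov2021, Remark 2.11] -/
theorem frameCoord_kcVec_mul_pow (v₀ : Site 2) (n j : ℕ) (a d : ℝ) :
    frameCoord v₀ (kcVec v₀ n a d) * (1 + I) ^ (n + j) =
      ((a : ℂ) - d * I) * (frameNorm v₀ n : ℂ) * (1 + I) ^ j := by
  have hN : (frameNorm v₀ n : ℂ) ≠ 0 := ofReal_ne_zero.2 (frameNorm_pos v₀ n).ne'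
  have hη : frameVec v₀ * conj (frameVec v₀) = (Real.sqrt 2 : ℂ) := by
    rw [mul_conj, normSq_eq_norm_sq, norm_frameVec_sq]
  have hN2 : (frameNorm v₀ n : ℂ) * (frameNorm v₀ n : ℂ) = (Real.sqrt 2 : ℂ) * 2 ^ n := by
    rw [← ofReal_mul, ← sq, frameNorm_sq]; push_cast; ring
  rw [frameCoord, kcVec, pow_add]
  field_simp
  linear_combination ((a : ℂ) - d * I) * (1 + I) ^ j *
    ((1 - I) ^ n * (1 + I) ^ n * hη - hN2 + (Real.sqrt 2 : ℂ) * one_sub_I_pow_mul_one_add_I_pow n)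

/-- `Re` of the frame coordinate on the line `n` itself: `a N_n`. [cite: ChelkakHonglerIzyurov2021, Remark 2.11] -/
theorem re_frameCoord_kcVec_zero (v₀ : Site 2) (n : ℕ) (a d : ℝ) :
    (frameCoord v₀ (kcVec v₀ n a d) * (1 + I) ^ n).re = a * frameNorm v₀ n := by
  have h := frameCoord_kcVec_mul_pow v₀ n 0 a d
  rw [add_zero, pow_zero, mul_one] at h
  rw [h]; simp

/-- On the line `n + 1` (an eighth-turn away): `(a + d) N_n`. [cite: ChelkakHonglerIzyurov2021, Remark 2.11] -/
theorem re_frameCoord_kcVec_one (v₀ : Site 2) (n : ℕ) (a d : ℝ) :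
    (frameCoord v₀ (kcVec v₀ n a d) * (1 + I) ^ (n + 1)).re = (a + d) * frameNorm v₀ n := by
  rw [frameCoord_kcVec_mul_pow v₀ n 1 a d, pow_one]; simp; ring

/-- On the orthogonal line `n + 2`: `2 d N_n`. [cite: ChelkakHonglerIzyurov2021, Remark 2.11] -/
theorem re_frameCoord_kcVec_two (v₀ : Site 2) (n : ℕ) (a d : ℝ) :
    (frameCoord v₀ (kcVec v₀ n a d) * (1 + I) ^ (n + 2)).re = 2 * d * frameNorm v₀ n := by
  rw [frameCoord_kcVec_mul_pow v₀ n 2 a d, one_add_I_sq]; simp; ring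

/-- On the line `n + 3`: `-2 (a - d) N_n` (the sign is the sheet change of the Dirac spinor `η_z`
after three eighth-turns, Chelkak–Hongler–Izyurov 2021, eq. (1.4)). [cite: ChelkakHonglerIzyurov2021, Remark 2.11] -/
theorem re_frameCoord_kcVec_three (v₀ : Site 2) (n : ℕ) (a d : ℝ) :
    (frameCoord v₀ (kcVec v₀ n a d) * (1 + I) ^ (n + 3)).re = -2 * (a - d) * frameNorm v₀ n := by
  rw [frameCoord_kcVec_mul_pow v₀ n 3 a d, one_add_I_pow_three]; simp; ring

/-- **The four projections of the bond value** (Chelkak–Hongler–Izyurov 2021, Remark 2.11 /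
Chelkak–Hongler–Izyurov 2015, Def. 2.3, `F(x) = P_{ℓ(x)}[F(z)]`, in squared-length form): the
projections of `kcVec n a d` onto the corner lines of frame index `n`, `n + 1`, `n + 2`, `n + 3` have
squared lengths `a²`, `(a + d)²/2`, `d²`, `(a - d)²/2`. Index `n`. [cite: ChelkakHonglerIzyurov2021, Remark 2.11] -/
theorem norm_projLine_kcVec_sq_zero (v₀ v : Site 2) (k : Fin 4) {n : ℕ} (hn : n % 4 = (k : ℕ))
    (a d : ℝ) : ‖projLine (cornerLine v (faceAt v k)) (kcVec v₀ n a d)‖ ^ 2 = a ^ 2 := by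
  rw [norm_projLine_cornerLine_sq v₀ v k hn, re_frameCoord_kcVec_zero, ← frameNorm_sq]
  have h := (frameNorm_pos v₀ n).ne'
  field_simp

/-- Index `n + 1`: squared length `(a + d)²/2`. [cite: ChelkakHonglerIzyurov2021, Remark 2.11] -/
theorem norm_projLine_kcVec_sq_one (v₀ v : Site 2) (k : Fin 4) {n : ℕ} (hn : n % 4 = (k : ℕ))
    (a d : ℝ) :
    ‖projLine (cornerLine v (faceAt v (k + 1))) (kcVec v₀ n a d)‖ ^ 2 = (a + d) ^ 2 / 2 := by
  have hj : (n + 1) % 4 = ((k + 1 : Fin 4) : ℕ) := frame_index hn 1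
  rw [norm_projLine_cornerLine_sq v₀ v (k + 1) hj, re_frameCoord_kcVec_one, pow_add,
    ← mul_assoc, ← frameNorm_sq]
  have h := (frameNorm_pos v₀ n).ne'
  field_simp

/-- Index `n + 2`: squared length `d²`. [cite: ChelkakHonglerIzyurov2021, Remark 2.11] -/
theorem norm_projLine_kcVec_sq_two (v₀ v : Site 2) (k : Fin 4) {n : ℕ} (hn : n % 4 = (k : ℕ))
    (a d : ℝ) :
    ‖projLine (cornerLine v (faceAt v (k + 2))) (kcVec v₀ n a d)‖ ^ 2 = d ^ 2 := by
  have hj : (n + 2) % 4 = ((k + 2 : Fin 4) : ℕ) := frame_index hn 2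
  rw [norm_projLine_cornerLine_sq v₀ v (k + 2) hj, re_frameCoord_kcVec_two, pow_add,
    ← mul_assoc, ← frameNorm_sq]
  have h := (frameNorm_pos v₀ n).ne'
  field_simp

/-- Index `n + 3`: squared length `(a - d)²/2`. [cite: ChelkakHonglerIzyurov2021, Remark 2.11] -/
theorem norm_projLine_kcVec_sq_three (v₀ v : Site 2) (k : Fin 4) {n : ℕ} (hn : n % 4 = (k : ℕ))
    (a d : ℝ) :
    ‖projLine (cornerLine v (faceAt v (k + 3))) (kcVec v₀ n a d)‖ ^ 2 = (a - d) ^ 2 / 2 := by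
  have hj : (n + 3) % 4 = ((k + 3 : Fin 4) : ℕ) := frame_index hn 3
  rw [norm_projLine_cornerLine_sq v₀ v (k + 3) hj, re_frameCoord_kcVec_three, pow_add,
    ← mul_assoc, ← frameNorm_sq]
  have h := (frameNorm_pos v₀ n).ne'
  field_simp

end Frame

/-! ### The critical Kadanoff–Ceva fermion at a bond of `ℤ²` (Chelkak–Hongler–Izyurov 2021, Lemma 2.12) -/

section Bond

variable (G₂ : SimpleGraph (Site 2)) [G₂.LocallyFinite]

/-- **The critical fermion at the bond of the dart `(x, k)`**, `e = {x, x + cornerUnit k}`, for the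
cut `T` (not containing `e`) ending at the plaquette `faceAt x k` on the left of the dart: the complex
number whose projections onto the lines of the opposite corners `(x, k)` and `(x + cornerUnit k, k + 2)`
are the corner values `X_B(x, T)` and `X_B(x + cornerUnit k, T ∪ {e})` (Chelkak–Hongler–Izyurov 2021,
Def. 2.8 with Remark 2.11; frame based at the origin, index `n = k`). [cite: ChelkakHonglerIzyurov2021, Def. 2.8 and Remark 2.11] -/
def kcBondVec (Λ : Finset (Site 2)) (bc : BoundaryCondition (Site 2)) (B : Finset (Site 2))
    (T : Finset (Sym2 (Site 2))) (x : Site 2) (k : Fin 4) : ℂ :=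
  kcVec 0 (k : ℕ) (kcCorner G₂ Λ criticalBetaTwo bc B T x)
    (kcCorner G₂ Λ criticalBetaTwo bc B (insert (cSrc (x, k)) T) (x + cornerUnit k))

variable (Λ : Finset (Site 2)) (bc : BoundaryCondition (Site 2)) (B : Finset (Site 2))

/-- **s-holomorphicity of the critical fermion, corner `(x, k)`** (Chelkak–Hongler–Izyurov 2021,
Lemma 2.12 with Remark 2.11; Chelkak–Hongler–Izyurov 2015, Prop. 2.4 / Def. 2.3: `F(x) = P_{ℓ(x)} F(z)`):
the projection of the bond value onto the line of the corner `(x, k)` (plaquette `faceAt x k`) has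
squared length `X_B(x, T)²`. [cite: ChelkakHonglerIzyurov2021, Lemma 2.12; ChelkakHonglerIzyurovAnnals2015, Prop. 2.4] -/
theorem norm_projLine_kcBondVec_sq_zero (T : Finset (Sym2 (Site 2))) (x : Site 2) (k : Fin 4) :
    ‖projLine (cornerLine x (faceAt x k)) (kcBondVec G₂ Λ bc B T x k)‖ ^ 2 =
      kcCorner G₂ Λ criticalBetaTwo bc B T x ^ 2 :=
  norm_projLine_kcVec_sq_zero 0 x k (Nat.mod_eq_of_lt k.isLt) _ _

/-- **Corner `(x + cornerUnit k, k + 2)`** (plaquette `faceAt x (k + 3)` on the right of the dart,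
`faceAt_add_unit_add_two`): squared projection `X_B(x + cornerUnit k, T ∪ {e})²`.
[cite: ChelkakHonglerIzyurov2021, Lemma 2.12; ChelkakHonglerIzyurovAnnals2015, Prop. 2.4] -/
theorem norm_projLine_kcBondVec_sq_two (T : Finset (Sym2 (Site 2))) (x : Site 2) (k : Fin 4) :
    ‖projLine (cornerLine (x + cornerUnit k) (faceAt (x + cornerUnit k) (k + 2)))
        (kcBondVec G₂ Λ bc B T x k)‖ ^ 2 =
      kcCorner G₂ Λ criticalBetaTwo bc B (insert (cSrc (x, k)) T) (x + cornerUnit k) ^ 2 :=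
  norm_projLine_kcVec_sq_two 0 _ k (Nat.mod_eq_of_lt k.isLt) _ _

/-- **Corner `(x + cornerUnit k, k + 1)`** (the other corner at the left plaquette `faceAt x k`,
`faceAt_add_unit_succ`): squared projection `X_B(x + cornerUnit k, T)²` — this is where the critical
propagation identity `X(x + u_k, T ∪ e) = √2 X(x + u_k, T) - X(x, T)` enters.
[cite: ChelkakHonglerIzyurov2021, Lemma 2.12; ChelkakHonglerIzyurovAnnals2015, Prop. 2.4] -/
theorem norm_projLine_kcBondVec_sq_one {T : Finset (Sym2 (Site 2))} {x : Site 2} {k : Fin 4}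
    (he : cSrc (x, k) ∉ T) :
    ‖projLine (cornerLine (x + cornerUnit k) (faceAt (x + cornerUnit k) (k + 1)))
        (kcBondVec G₂ Λ bc B T x k)‖ ^ 2 =
      kcCorner G₂ Λ criticalBetaTwo bc B T (x + cornerUnit k) ^ 2 := by
  rw [kcBondVec, norm_projLine_kcVec_sq_one 0 _ k (Nat.mod_eq_of_lt k.isLt), cSrc,
    kcCorner_insert_critical' G₂ Λ bc B he]
  have h2 : Real.sqrt 2 ^ 2 = 2 := Real.sq_sqrt zero_le_two
  field_simp
  linear_combination kcCorner G₂ Λ criticalBetaTwo bc B T (x + cornerUnit k) ^ 2 * h2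

/-- **Corner `(x, k + 3)`** (the other corner at the right plaquette): squared projection
`X_B(x, T ∪ {e})²`, by the critical propagation identity `X(x, T ∪ e) = √2 X(x, T) - X(x + u_k, T)`.
Together with the three preceding statements: the four corner values of the bond are the four
projections of ONE complex number — the s-holomorphicity of the critical Kadanoff–Ceva fermion
(Chelkak–Hongler–Izyurov 2021, Lemma 2.12), i.e. of the spinor observable (Chelkak–Hongler–Izyurov
2015, Prop. 2.4), in the squared form that feeds the flux `|F(corner)|²` of the discrete primitive
`H` (Chelkak–Hongler–Izyurov 2015, Prop. 3.6; tree: `cornerFlux`).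
[cite: ChelkakHonglerIzyurov2021, Lemma 2.12; ChelkakHonglerIzyurovAnnals2015, Prop. 2.4] -/
theorem norm_projLine_kcBondVec_sq_three {T : Finset (Sym2 (Site 2))} {x : Site 2} {k : Fin 4}
    (he : cSrc (x, k) ∉ T) :
    ‖projLine (cornerLine x (faceAt x (k + 3))) (kcBondVec G₂ Λ bc B T x k)‖ ^ 2 =
      kcCorner G₂ Λ criticalBetaTwo bc B (insert (cSrc (x, k)) T) x ^ 2 := by
  rw [kcBondVec, norm_projLine_kcVec_sq_three 0 _ k (Nat.mod_eq_of_lt k.isLt), cSrc,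
    kcCorner_insert_critical' G₂ Λ bc B he, kcCorner_insert_critical G₂ Λ bc B he]
  have h2 : Real.sqrt 2 ^ 2 = 2 := Real.sq_sqrt zero_le_two
  field_simp
  linear_combination (kcCorner G₂ Λ criticalBetaTwo bc B T (x + cornerUnit k) ^ 2 -
    2 * kcCorner G₂ Λ criticalBetaTwo bc B T x ^ 2) * h2

/-- The two plaquettes of the bond: the corners `(x, k)` and `(x + cornerUnit k, k + 1)` lie at the
same plaquette, and so do `(x, k + 3)` and `(x + cornerUnit k, k + 2)` (restating
`faceAt_add_unit_succ`, `faceAt_add_unit_add_two` for the reader of this file). [cite: ChelkakHonglerIzyurov2021, Remark 2.11] -/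
theorem kcBond_faces (x : Site 2) (k : Fin 4) :
    faceAt (x + cornerUnit k) (k + 1) = faceAt x k ∧ faceAt (x + cornerUnit k) (k + 2) = faceAt x (k + 3) :=
  ⟨faceAt_add_unit_succ x k, faceAt_add_unit_add_two x k⟩

end Bond

/-! ### Cut systems on a set of plaquettes and the discrete primitive of `X²` -/

section CutSystem

variable (G₂ : SimpleGraph (Site 2)) [G₂.LocallyFinite]

/-- **The flux form of a cut system**: the corner form `(v, k) ↦ X_B(v, T_{p})²`, `p = faceAt v k`
the plaquette of the corner and `T_p = cut p` the branch cut ending there — the increment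
`|F(corner)|²` of the discrete primitive `H = Re ∫ F²` across the corner (Chelkak–Hongler–Izyurov
2015, Prop. 3.6, eq. (3.4), up to the factor `2δ`; it does not depend on the sheet).
[cite: ChelkakHonglerIzyurovAnnals2015, Prop. 3.6] -/
def kcFlux (Λ : Finset (Site 2)) (β : ℝ) (bc : BoundaryCondition (Site 2)) (B : Finset (Site 2))
    (cut : Site 2 → Finset (Sym2 (Site 2))) (q : Site 2 × Fin 4) : ℝ :=
  kcCorner G₂ Λ β bc B (cut (cFace q)) q.1 ^ 2

/-- **A system of branch cuts on a set `P` of plaquettes**: every cut is made of bonds touching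
`Λ`, and across every bond interior to `P` (both plaquettes `faceAt u k`, `faceAt u (k + 3)` in `P`)
the two cuts differ by that bond and a gauge move `∂S`, `S ⊆ Λ` — the lattice version of "a branch
cut for the double cover `[Ω_δ, a]` ending at the plaquette", moved from plaquette to plaquette as in
Chelkak–Hongler–Izyurov 2021, §2.2 (before Lemma 2.6) and proof of Lemma 2.12.
[cite: ChelkakHonglerIzyurov2021, §2.2 and Lemma 2.12] -/
structure IsKCCutSystem (Λ : Finset (Site 2)) (cut : Site 2 → Finset (Sym2 (Site 2)))
    (P : Set (Site 2)) : Prop where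
  /-- Cuts consist of bonds touching the volume. -/
  subset : ∀ p ∈ P, cut p ⊆ edgesTouching G₂ Λ
  /-- Across an interior bond the cuts differ by the bond and a gauge move. -/
  step : ∀ (u : Site 2) (k : Fin 4), faceAt u k ∈ P → faceAt u (k + 3) ∈ P →
    cSrc (u, k) ∈ edgesTouching G₂ Λ ∧
      ∃ S : Finset (Site 2), S ⊆ Λ ∧
        cut (faceAt u (k + 3)) = symmDiff (symmDiff (cut (faceAt u k)) {cSrc (u, k)}) (edgeBoundary G₂ S)

/-- **The flux form of a cut system is closed** on its set of plaquettes (fixed boundary condition,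
any `β`): around every interior bond the identity of `kcCorner_sq_cycle` is the cycle condition
`IsCornerClosedAt` of `CornerPotential.lean` (Smirnov 2010, Lemma 3.6 / Chelkak–Hongler–Izyurov
2015, Prop. 3.6: the increments `|F(corner)|²` integrate to a single-valued `H`).
[cite: ChelkakHonglerIzyurovAnnals2015, Prop. 3.6; Smirnov2010, Lemma 3.6] -/
theorem isCornerClosedOn_kcFlux {Λ : Finset (Site 2)} (β : ℝ) (η : SpinConfig (Site 2))
    (B : Finset (Site 2)) {cut : Site 2 → Finset (Sym2 (Site 2))} {P : Set (Site 2)}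
    (h : IsKCCutSystem G₂ Λ cut P) : IsCornerClosedOn (kcFlux G₂ Λ β (.fixed η) B cut) P := by
  intro u k hk hk3
  obtain ⟨he, S, hS, hcut⟩ := h.step u k hk hk3
  have hc := kcCorner_sq_cycle G₂ hS β η B (h.subset _ hk) (u := u) (u' := u + cornerUnit k) he
  simp only [IsCornerClosedAt, kcFlux, cFace, faceAt_add_unit_succ, faceAt_add_unit_add_two, hcut, cSrc]
  exact hc

/-- **Existence of the discrete primitive `H` of `X²` on a hole-free set of plaquettes**
(Chelkak–Hongler–Izyurov 2015, Prop. 3.6, first item: "one can define a real-valued function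
`H_δ` … so that `H°(w) - H•(v) = 2δ|F_δ(½(w+v))|²`"; Smirnov 2010, Lemma 3.6), for the Kadanoff–Ceva
corner values of any cut system: there are `Hw` on sites and `Hb` on plaquettes with
`Hb(p) - Hw(v) = X_B(v, T_p)²` at every corner `(v, p)` of a plaquette `p ∈ P`. The topology is the
tree's discrete Poincaré lemma `exists_potential_of_holeFree`. (Sign convention of the tree —
`H` increases from a site to its plaquettes —, i.e. `-H_δ/(2δ)` in the convention of
Chelkak–Hongler–Izyurov 2015.) [cite: ChelkakHonglerIzyurovAnnals2015, Prop. 3.6; Smirnov2010, Lemma 3.6] -/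
theorem exists_kcPrimitive {Λ : Finset (Site 2)} (β : ℝ) (η : SpinConfig (Site 2)) (B : Finset (Site 2))
    {cut : Site 2 → Finset (Sym2 (Site 2))} {P : Finset (Site 2)} (hP : HoleFree (↑P : Set (Site 2)))
    (h : IsKCCutSystem G₂ Λ cut ↑P) :
    ∃ Hw Hb : Site 2 → ℝ, ∀ q ∈ faceSetCorners (↑P : Set (Site 2)),
      Hb (cFace q) - Hw q.1 = kcFlux G₂ Λ β (.fixed η) B cut q :=
  exists_potential_of_holeFree _ P hP (isCornerClosedOn_kcFlux G₂ β η B h)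

end CutSystem

end Literature.Probability.LatticeModels
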